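import Mathlib.Data.NNReal.Basic
import Mathlib.Algebra.Group.Equiv.Basic
import Mathlib.Algebra.Group.End
import Mathlib.GroupTheory.Torsion
import Mathlib.Tactic.FieldSimp
import HarnessLib

/-!
# [IUTchII] Propositions 4.2, 4.4: Frobenioid-theoretic Gaussian monoids at good primes;
# Remarks 4.2.1, 4.4.1

S. Mochizuki, *Inter-universal Teichmüller theory II*, §4, Proposition 4.2 (i)–(iv) (good
nonarchimedean `v`, kurims Dec-2020 manuscript pp. 123–125), Remark 4.2.1 (i)–(iv) (pp. 125–126),
Proposition 4.4 (i)–(iv) (archimedean `v`, pp. 129–131), Remark 4.4.1 (p. 131)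
[cite: Mochizuki2012, Prop 4.2 p.123]. Claim key DISPUTED (D-0012): definitions, interfaces and
Prop-valued statements only; nothing asserted.

**What is printed.** For a `p_v`-adic Frobenioid `†F_v` in a Θ-Hodge theater (base `B^temp(†Π_v)^0`)
with `G_v(†Π_v) ↷ Ψ_{†F_v}` and `†G_v ↷ Ψ_{†F^⊢_v}`: (4.2 (i)) "a unique `G_v(†Π_v)`-equivariant isomorphism of
monoids `Ψ_{†F_v} ⥲ Ψ_cns(†Π_v)`"; (4.2 (ii)) "a unique `†G_v`-equivariant `Ẑ^×`-orbit of isomorphisms of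
topological groups `Ψ^×_{†F^⊢_v} ⥲ Ψ_cns(†G_v)^×` … as well as a unique isomorphism of monoids
`Ψ^R_{†F^⊢_v} := (Ψ_{†F^⊢_v}/Ψ^×_{†F^⊢_v})^rlf ⥲ Ψ^R_cns(†G_v)` that maps the distinguished element of `Ψ^R_{†F^⊢_v}`
determined by the unique generator of `Ψ_{†F^⊢_v}/Ψ^×_{†F^⊢_v}` to the distinguished element of `Ψ^R_cns(†G_v)`
determined by `log^{†G_v}(p_v)`"; `Ψ^ss_{†F^⊢_v} := Ψ^×_{†F^⊢_v} × Ψ^R_{†F^⊢_v}` with "a natural poly-isomorphism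
… `Ψ^ss_{†F^⊢_v} ⥲ Ψ^ss_cns(†G_v)`" and "a natural isomorphism [i.e., as opposed to a poly-isomorphism!]
`Ψ^ss_{†F_v} ⥲ Ψ^ss_{†F^⊢_v}`"; (4.2 (iii)) labeled compatible isomorphisms `(Ψ_{†F_v})_t ⥲ Ψ_cns(†Π_v)_t`,
`F_l^⋊±`-symmetrizing isomorphisms, and `(Ψ_{†F_v})_0 ⥲ (Ψ_{†F_v})_{⟨F_l^⋇⟩}`; (4.2 (iv)) `Ψ_{†F^Θ_v}`,
`Ψ_{F_gau}(†F_v)` "determined … via the isomorphisms of (i), (ii), (iii) by the monoids `Ψ_env(†Π_v)`,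
`Ψ_gau(†Π_v)`" with "natural isomorphisms `Ψ_{†F^Θ_v} ⥲ Ψ_env(†Π_v) ⥲ Ψ_gau(†Π_v) ⥲ Ψ_{F_gau}(†F_v)`".
Prop 4.4 prints the archimedean analogue: (i) the Kummer structure `†κ_v : Ψ_{†F_v} := O^▷(†C_v) ↪ A^{†D_v}`
and `†D_v = †U_v` "determine a unique isomorphism `Ψ_{†F_v} ⥲ Ψ_cns(†U_v)`"; (ii) "a unique `{±1}`-orbit
of isomorphisms of topological groups `Ψ^×_{†F^⊢_v} ⥲ Ψ_cns(†D^⊢_v)^×`" and "a unique isomorphism of monoids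
`Ψ^R_{†F^⊢_v} := Ψ_{†F^⊢_v}/Ψ^×_{†F^⊢_v} ⥲ Ψ^R_cns(†D^⊢_v) := ℝ_{≥0}(†D^⊢_v)`" matching the distinguished element
"determined by `p_v = e = 2.71828…`" with `log^{†D^⊢_v}(p_v)`; (iii), (iv) as in 4.2. Remark 4.2.1
(i): the bad-prime analogues `Ψ^ss_cns(†G_v)`, `ℝ_{≥0}(†G_v)`, `log^{†G_v}(p_v)` and "a functorial
group-theoretic … `Π_v`-equivariant isomorphism `Ψ_cns(Π_v)^× ⥲ Ψ^ss_cns(G_v(Π_v))^×`"; (iii)/(iv): the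
notation `Ψ_env(B^temp(Π_v)^0)` etc. for data "considered only up to a `Π_v`-inner automorphism
indeterminacy". Remark 4.4.1: the archimedean analogue of 4.2.1 (ii).

**Dictionary and what is proved.** The realified rank-one monoids `Ψ^R`, `ℝ_{≥0}(−)` are recorded AS
`ℝ≥0` with a distinguished positive element (`PointedHalfLine`). PROVED: the scaling isomorphism
`x ↦ (b/a)·x` is an isomorphism of monoids matching the distinguished elements
(`PointedHalfLine.scaleIso`, `scaleIso_pt`); its UNIQUENESS among all monoid isomorphisms — the
printed "unique isomorphism of monoids" — is the statement `PointedHalfLine.IsoUnique` (it amounts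
to "additive self-maps of `ℝ≥0` are linear"; discharged in a separate proof file). The unit-group,
Galois and Kummer clauses are Prop-valued interface fields quoting print (`Prop42Statements`,
`Prop44Statements`, `Remark421Statements`). -- TODO-merge: abc-iut-L5-t2 ([IUTchI] Ex 3.3, 3.4,
-- Def 5.2), abc-iut-L4-t2 ([AbsTopIII] Prop 3.2 (iv), 3.3 (ii)), abc-iut-L6-t1 (Rmk 1.11.1).
-/

namespace Literature.IUT.HodgeArakelov

open scoped NNReal

/-! ### 1. Realified rank-one monoids with a distinguished element -/

/-- A realified rank-one monoid with a distinguished element: `Ψ^R_{†F^⊢_v} = (Ψ_{†F^⊢_v}/Ψ^×_{†F^⊢_v})^rlf`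
with "the distinguished element … determined by the unique generator of `Ψ_{†F^⊢_v}/Ψ^×_{†F^⊢_v}`", or
`Ψ^R_cns(†G_v) ⥲ ℝ_{≥0}(†G_v)` with `log^{†G_v}(p_v)` ([IUTchII] Prop 4.2 (ii) p. 124; Prop 4.4 (ii) p. 129–130
with `p_v = e`). Recorded AS `ℝ≥0` (additive) plus the element, which is positive.
[cite: Mochizuki2012, Prop 4.2 (ii) p.124] -/
structure PointedHalfLine where
  /-- the distinguished element -/
  pt : ℝ≥0
  /-- it is nonzero -/
  pt_pos : 0 < pt

namespace PointedHalfLine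

variable (A B : PointedHalfLine)

/-- The scaling isomorphism `x ↦ (b/a)·x` of `ℝ≥0` carrying the distinguished element `a` of `A` to the
distinguished element `b` of `B` — the isomorphism whose existence and uniqueness Prop 4.2 (ii)
p. 124 / Prop 4.4 (ii) p. 130 assert ("a unique isomorphism of monoids … that maps the distinguished
element … to the distinguished element"). [cite: Mochizuki2012, Prop 4.2 (ii) p.124] -/
noncomputable def scaleIso : ℝ≥0 ≃+ ℝ≥0 where
  toFun x := B.pt / A.pt * x
  invFun y := A.pt / B.pt * y
  left_inv x := by
    have ha := A.pt_pos.ne'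
    have hb := B.pt_pos.ne'
    field_simp
  right_inv y := by
    have ha := A.pt_pos.ne'
    have hb := B.pt_pos.ne'
    field_simp
  map_add' x y := by ring

/-- The scaling isomorphism maps the distinguished element to the distinguished element.
[cite: Mochizuki2012, Prop 4.2 (ii) p.124] -/
theorem scaleIso_pt : scaleIso A B A.pt = B.pt := by
  have ha := A.pt_pos.ne'
  simp only [scaleIso, AddEquiv.coe_mk, Equiv.coe_fn_mk]
  field_simp

/-- STATEMENT (the "unique" of Prop 4.2 (ii) p. 124 / Prop 4.4 (ii) p. 130): any isomorphism of
monoids `ℝ≥0 ⥲ ℝ≥0` carrying `a` to `b` is the scaling isomorphism. (Equivalent to: additive self-maps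
of `ℝ≥0` are `ℝ≥0`-linear; discharged separately.) [cite: Mochizuki2012, Prop 4.2 (ii) p.124] -/
def IsoUnique : Prop := ∀ e : ℝ≥0 ≃+ ℝ≥0, e A.pt = B.pt → e = scaleIso A B

end PointedHalfLine

/-- `Ψ^ss_{†F^⊢_v} := Ψ^×_{†F^⊢_v} × Ψ^R_{†F^⊢_v}`, the "semi-simplified version" of `Ψ_{†F^⊢_v}` ([IUTchII] Prop 4.2
(ii) p. 124; Prop 4.4 (ii) p. 130), over an abstract unit group `U` and with `Ψ^R = ℝ≥0`
(multiplicative notation on the second factor suppressed: we keep the additive `ℝ≥0`).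
[cite: Mochizuki2012, Prop 4.2 (ii) p.124] -/
abbrev SemiSimplifiedFrob (U : Type*) [CommGroup U] : Type _ := U × Multiplicative ℝ≥0

/-! ### 2. Propositions 4.2, 4.4 and Remarks 4.2.1, 4.4.1 as named statements -/

/-- INTERFACE, [IUTchII] Proposition 4.2 (i)–(iv) pp. 123–125 (`v ∈ V^good ∩ V^non`), over named
inputs: the `p_v`-adic Frobenioid `†F_v` of the Θ-Hodge theater with `G_v(†Π_v) ↷ Ψ_{†F_v}`, the
`F^⊢`-prime-strip datum `†G_v ↷ Ψ_{†F^⊢_v}`, and the group-theoretic monoids `Ψ_cns(†Π_v)`, `Ψ^ss_cns(†G_v)`,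
`Ψ_env(†Π_v)`, `Ψ_gau(†Π_v)` of Prop 4.1. One Prop-valued field per printed sub-item; none asserted.
[cite: Mochizuki2012, Prop 4.2 p.123] -/
structure Prop42Statements where
  /-- (i) p. 124 (Constant monoids): "There exists a unique `G_v(†Π_v)`-equivariant isomorphism of
  monoids `Ψ_{†F_v} ⥲ Ψ_cns(†Π_v)` — cf. Remark 1.11.1, (i), (a); [AbsTopIII], Proposition 3.2, (iv)". -/
  constantKummer : Prop
  /-- (ii) p. 124 (Mono-analytic semi-simplifications, unit part): "a unique `†G_v`-equivariant
  `Ẑ^×`-orbit of isomorphisms of topological groups `Ψ^×_{†F^⊢_v} ⥲ Ψ_cns(†G_v)^×` — cf. Remark 1.11.1, (i),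
  (b); [AbsTopIII], Proposition 3.3, (ii)". -/
  unitOrbit : Prop
  /-- (ii) p. 124 (realified part): "a unique isomorphism of monoids `Ψ^R_{†F^⊢_v} ⥲ Ψ^R_cns(†G_v)` that
  maps the distinguished element … to the distinguished element" (= `PointedHalfLine.scaleIso` with
  `PointedHalfLine.IsoUnique`), the induced "natural poly-isomorphism … `Ψ^ss_{†F^⊢_v} ⥲ Ψ^ss_cns(†G_v)`
  … compatible with the natural splittings", and the "natural isomorphism `Ψ^ss_{†F_v} ⥲ Ψ^ss_{†F^⊢_v}`". -/
  realifiedIso : Prop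
  /-- (iii) p. 124–125 (Labels, `F_l^⋊±`-symmetries, conjugate synchronization): "for each
  `t ∈ LabCusp^±(†Π_v)`, a collection of compatible isomorphisms `(Ψ_{†F_v})_t ⥲ Ψ_cns(†Π_v)_t` …
  well-defined up to composition with an inner automorphism of `†Π_v` which is independent of `t`",
  `F_l^⋊±`-symmetrizing isomorphisms induced by the `†Δ^±_v`-outer action of `F_l^⋊± ≅ †Δ^cor_v/†Δ^±_v`,
  and "an isomorphism of ind-topological monoids `(Ψ_{†F_v})_0 ⥲ (Ψ_{†F_v})_{⟨F_l^⋇⟩}`". -/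
  symmetrizing : Prop
  /-- (iv) p. 125 (Theta and Gaussian monoids): `Ψ_{†F^Θ_v}`, `Ψ_{F_gau}(†F_v)` "determined, respectively —
  via the isomorphisms of (i), (ii), and (iii) — by the monoids `Ψ_env(†Π_v)`, `Ψ_gau(†Π_v)`", with "a
  collection of natural isomorphisms `Ψ_{†F^Θ_v} ⥲ Ψ_env(†Π_v) ⥲ Ψ_gau(†Π_v) ⥲ Ψ_{F_gau}(†F_v)` — which
  restrict to the identity or to the … isomorphism of (i) … on the various copies of `Ψ^×_{†F_v}`,
  `Ψ_cns(†Π_v)^×` and are compatible with the various natural actions of `G_v(†Π_v)` and natural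
  splittings". -/
  thetaGaussian : Prop

/-- INTERFACE, [IUTchII] Proposition 4.4 (i)–(iv) pp. 129–131 (`v ∈ V^arc`), over named inputs: the
triple `†F_v = (†C_v, †D_v, †κ_v)` of the Θ-Hodge theater ([IUTchI] Ex 3.4 (i)), `†F^⊢_v = (†C^⊢_v, †D^⊢_v,
†τ^⊢_v)`, the Aut-holomorphic orbispaces `†U_v = †D_v`, `†U^±_v`, `†U^cor_v`, and the monoids of Prop 4.3.
One Prop-valued field per printed sub-item; none asserted. [cite: Mochizuki2012, Prop 4.4 p.129] -/
structure Prop44Statements where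
  /-- (i) p. 129 (Constant monoids): "the Kummer structure `†κ_v : Ψ_{†F_v} := O^▷(†C_v) ↪ A^{†D_v}` …,
  together with the tautological equality `†D_v = †U_v` …, determine a unique isomorphism
  `Ψ_{†F_v} ⥲ Ψ_cns(†U_v)` of topological monoids". -/
  constantKummer : Prop
  /-- (ii) p. 129–130 (unit part): "a unique `{±1}`-orbit of isomorphisms of topological groups
  `Ψ^×_{†F^⊢_v} ⥲ Ψ_cns(†D^⊢_v)^×`". -/
  unitOrbit : Prop
  /-- (ii) p. 130 (realified part): "a unique isomorphism of monoids `Ψ^R_{†F^⊢_v} := Ψ_{†F^⊢_v}/Ψ^×_{†F^⊢_v} ⥲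
  Ψ^R_cns(†D^⊢_v) := ℝ_{≥0}(†D^⊢_v)` that maps the distinguished element … determined by `p_v = e = 2.71828…`
  … to the distinguished element … determined by `log^{†D^⊢_v}(p_v)`", the poly-isomorphism
  `Ψ^ss_{†F^⊢_v} ⥲ Ψ^ss_cns(†D^⊢_v)` and the natural isomorphism `Ψ^ss_{†F_v} ⥲ Ψ^ss_{†F^⊢_v}`. -/
  realifiedIso : Prop
  /-- (iii) p. 130 (Labels, `F_l^⋊±`-symmetries): labeled isomorphisms `(Ψ_{†F_v})_t ⥲ Ψ_cns(†U_v)_t`,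
  `F_l^⋊±`-symmetrizing isomorphisms "induced by the action of `F_l^⋊± ≅ Gal(†U^±_v/†U^cor_v)` on the
  various `Gal(†U_v/†U^±_v)`-orbits of cusps of `†U_v`", and `(Ψ_{†F_v})_0 ⥲ (Ψ_{†F_v})_{⟨F_l^⋇⟩}`. -/
  symmetrizing : Prop
  /-- (iv) p. 130–131 (Theta and Gaussian monoids): `Ψ_{†F^Θ_v}`, `Ψ_{F_gau}(†F_v)` with "natural
  isomorphisms `Ψ_{†F^Θ_v} ⥲ Ψ_env(†U_v) ⥲ Ψ_gau(†U_v) ⥲ Ψ_{F_gau}(†F_v)`" restricting to the identity or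
  to the isomorphism of (i) on the copies of `Ψ^×_{†F_v}`, `Ψ_cns(†U_v)^×`, compatible with the natural
  splittings. -/
  thetaGaussian : Prop

/-- INTERFACE, [IUTchII] Remark 4.2.1 (i), (iii), (iv) pp. 125–126 and Remark 4.4.1 p. 131 (Remark
4.2.1 (ii) — `∞Ψ := Ψ` at good `v` — is typed with Prop 4.1): (i) "one may define, in the case of
`v ∈ V^bad` — via the same group-theoretic algorithms … — ind-topological monoids `Ψ^ss_cns(†G_v)`,
`ℝ_{≥0}(†G_v)` …, a distinguished element `log^{†G_v}(p_v) ∈ ℝ_{≥0}(†G_v)`, and a tautological splitting",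
and, writing `Ψ_cns(Π_v) := Ψ_cns(M^Θ_*(Π_v))`, "a functorial group-theoretic … `Π_v`-equivariant
isomorphism `Ψ_cns(Π_v)^× ⥲ Ψ^ss_cns(G_v(Π_v))^×`" with "analogues of «`Ψ^ss_{†F^⊢_v}`» and of Proposition 4.2,
(i), (ii), in the case of `v ∈ V^bad`. We leave the routine details to the reader."; (iii)/(iv) the
notation `Ψ_env(B^temp(Π_v)^0)`, `Ψ_gau(B^temp(Π_v)^0)`, `∞Ψ_env(B^temp(Π_v)^0)`, `∞Ψ_gau(B^temp(Π_v)^0)` for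
the pairs `G_v(Π_v) ↷ Ψ_env(Π_v)` etc. "regarded … up to an indeterminacy with respect to `Π_v`-inner
automorphisms", where at `v ∈ V^bad` `Ψ_env(Π_v) := Ψ_env(M^Θ_*(Π_v))`, `Ψ_gau(Π_v) := Ψ_gau(M^Θ_*(Π_v))`
(Cor 3.5 (ii)); Remark 4.4.1: the archimedean analogue of 4.2.1 (ii). Prop slots; none asserted.
-- TODO-merge: abc-iut-L5-t1 ([IUTchI] §0 `B^temp(Π)^0`), abc-iut-L6-t1 (Prop 1.2 `M^Θ_*(Π_v)`).
[cite: Mochizuki2012, Rmk 4.2.1 p.125] -/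
structure Remark421Statements where
  /-- 4.2.1 (i): bad-prime semi-simplifications and `Ψ_cns(Π_v)^× ⥲ Ψ^ss_cns(G_v(Π_v))^×` -/
  badSemiSimplified : Prop
  /-- 4.2.1 (iii): the `B^temp(Π_v)^0`-notation at good `v` (data up to `Π_v`-inner automorphism) -/
  btempNotationGood : Prop
  /-- 4.2.1 (iv): the `B^temp(Π_v)^0`-notation at bad `v`, `Ψ_env(Π_v) := Ψ_env(M^Θ_*(Π_v))` etc. -/
  btempNotationBad : Prop
  /-- 4.4.1: archimedean analogue of 4.2.1 (ii) -/
  archAnalogue : Prop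

end Literature.IUT.HodgeArakelov
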